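import Literature.AnabelianGeometry.EtaleTheta.SettingModelHeisenbergPresentation
import Literature.AnabelianGeometry.EtaleTheta.SettingModelAbelianShadow
import Literature.AnabelianGeometry.EtaleTheta.SettingModel
import HarnessLib

/-!
# A model of the [EtTh] §1 root: `Δ_Θ ≅ ℤ` EXACTLY at the root model (proof-only)

Mochizuki, *The étale theta function …*, Publ. RIMS **45** (2009) [EtTh], §1, PRIMS PDF p. 12: "`Δ_Θ (≅ Ẑ(1))`,
the image of `∧² Δ^ell_X` in `Δ^Θ_X := Δ_X/[Δ_X,[Δ_X,Δ_X]]`" [cite: MochizukiEtTh2009, §1 p.12]. PROOF-ONLY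
file of the abc-iut cell (prover abc-iut-w5-d125 gen 3; NV-L2 programme, root-model profile), sequel of
abc-iut-L2-t1's `SettingModel*.lean` (root model `ThetaSetting.model p`: `Π^tp_X = F₂ × G_{ℚ_p}` discrete),
abc-iut-L2-t1's part B `SettingModelAbelianShadow.lean` (`KEll ↔` vanishing exponent sums) and
abc-iut-L6-d6's `SettingModelHeisenbergPresentation.lean` (`Ker(F₂ ↠ Heis ℤ) = [[F₂,F₂],F₂]`).

WHAT IS PROVED. The tree knew `Δ_Θ(model)` to be infinite (abc-iut-w5-d028, p425309) and countable, hence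
`≇ Ẑ` (abc-iut-L2-t1, p421746). Here the EXACT structure:

* `mem_KTheta_of_mem_commutator_commutator`, `mem_KTheta_iff_of_snd_eq_one` — on `Δ^tp_X = F₂ × 1`:
  `g ∈ KTheta = toHat⁻¹([[Δ_X,Δ_X],Δ_X]⁻) ↔ heisHom g.1 = 1` (with L6-d6's kernel theorem: the profinite
  triple-commutator closure meets the discrete `F₂` exactly in `[[F₂,F₂],F₂]`);
* **`exists_mulEquiv_deltaTheta_int`** — `∃ e : Δ_Θ(model) ≃* ℤ` (multiplicative `ℤ`) computing the
  HEISENBERG `z`-COORDINATE: `e [(g,1)] = z(heisHom g)` for every `(g, 1) ∈ Π^tp_X` whose class lies in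
  `Δ_Θ`; in particular the class of `(⁅a,b⁆, 1)` goes to the generator `1`;
* `deltaTheta_eq_zpowers` — `Δ_Θ(model)` is the cyclic group generated by the class of `(⁅a,b⁆, 1)`.

So at the root model "`Δ_Θ ≅ Ẑ(1)`" degenerates to the untwisted DISCRETE `ℤ` = centre of `Heis ℤ` —
the number behind the certificates `not_nonempty_deltaTheta_mulEquiv_zHat` (p421746), `infinite_deltaTheta`
/ `not_isCompact_deltaTheta_model` (p425309), `model_isEmpty_kummerData` (p424679) and
`isEmpty_cyclotomeTower_model` (abc-iut-w5-d125). HONEST FRAMING: a statement about the degenerate model, not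
about [EtTh]; nothing asserts that abc is proved or refuted; no side is taken on [IUTchIII] Cor. 3.12.
-/

noncomputable section

namespace Literature.AnabelianGeometry.EtaleTheta.SettingModel

open scoped commutatorElement

variable (p : ℕ) [Fact p.Prime]

/-! ### `KTheta` on `Δ^tp_X = F₂ × 1` is the kernel of the Heisenberg shadow -/

/-- `[[F₂,F₂],F₂] × 1 ⊆ KTheta`: for `g` with trivial Galois component and `Del.val g.1 ∈ [[F₂,F₂],F₂]`,
`toHat g = (η(g.1), 1)` is a product of triple commutators of elements of `Δ_X = F̂₂ × 1`.
[cite: MochizukiEtTh2009, §1 p.12] -/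
theorem mem_KTheta_of_mem_commutator_commutator {g : PiTp p} (h2 : g.2 = 1)
    (h1 : Del.val g.1 ∈ ⁅⁅(⊤ : Subgroup F₂), (⊤ : Subgroup F₂)⁆, (⊤ : Subgroup F₂)⁆) : g ∈ KTheta p := by
  let ι : F₂ →* PiHt p := (MonoidHom.inl F₂hatT (GamHatT p)).comp eta
  have hι : ∀ u, ι u = (eta u, 1) := fun u => rfl
  have hrange : ι.range ≤ (curve p).DeltaHat := by
    rintro _ ⟨u, rfl⟩
    rw [hι]
    exact mk_one_mem_deltaHat p (eta u)
  have hg : (curve p).toHat g = ι (Del.val g.1) := by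
    change toHatM p g = _
    rw [toHatM_apply, hι, h2, map_one]
  change (curve p).toHat.toMonoidHom g ∈
    (⁅⁅(curve p).DeltaHat, (curve p).DeltaHat⁆, (curve p).DeltaHat⁆).topologicalClosure
  refine Subgroup.le_topologicalClosure _ ?_
  change (curve p).toHat g ∈ _
  rw [hg]
  have htop : (⊤ : Subgroup F₂).map ι = ι.range := (MonoidHom.range_eq_map ι).symm
  have hmap : (⁅⁅(⊤ : Subgroup F₂), (⊤ : Subgroup F₂)⁆, (⊤ : Subgroup F₂)⁆).map ι ≤
      ⁅⁅(curve p).DeltaHat, (curve p).DeltaHat⁆, (curve p).DeltaHat⁆ := by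
    rw [Subgroup.map_commutator, Subgroup.map_commutator, htop]
    exact Subgroup.commutator_mono (Subgroup.commutator_mono hrange hrange) hrange
  exact hmap ⟨Del.val g.1, h1, rfl⟩

/-- **The class-two shadow is exact on `Δ^tp_X = F₂ × 1`**: for `g ∈ Π^tp_X` with trivial Galois component,
`g ∈ KTheta ↔ heisHom (g.1) = 1` (`⇒`: abc-iut-L2-t1's `heisHom_eq_one_and_snd_eq_one_of_mem_KTheta`;
`⇐`: `Ker heisHom = [[F₂,F₂],F₂]`, abc-iut-L6-d6). [cite: MochizukiEtTh2009, §1 p.12] -/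
theorem mem_KTheta_iff_of_snd_eq_one {g : PiTp p} (h2 : g.2 = 1) :
    g ∈ KTheta p ↔ heisHom (Del.val g.1) = 1 := by
  constructor
  · exact fun hg => (heisHom_eq_one_and_snd_eq_one_of_mem_KTheta p hg).1
  · intro h
    refine mem_KTheta_of_mem_commutator_commutator p h2 ?_
    rw [← ker_heisHom_eq_commutator_commutator, MonoidHom.mem_ker]
    exact h

/-- A class in `Δ_Θ(model)` is represented by an element `(w, 1)` with BOTH exponent sums of `w` zero.
[cite: MochizukiEtTh2009, §1 p.12] -/
theorem exponents_eq_zero_of_mk_mem_deltaTheta {g : PiTp p}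
    (hg : ((g : GTheta p)) ∈ (ThetaSetting.model p).DeltaTheta) :
    (heisHom (Del.val g.1)).x = 0 ∧ (heisHom (Del.val g.1)).y = 0 ∧ g.2 = 1 :=
  exponents_eq_zero_and_snd_eq_one_of_mem_KEll p ((mk_mem_ker_thetaToEllM_iff p g).mp hg)

/-! ### `Δ_Θ(model) ≅ ℤ` by the Heisenberg `z`-coordinate -/

/-- **`Δ_Θ ≅ ℤ` at the root model, EXACTLY**: there is a group isomorphism `e : Δ_Θ(model) ≃* ℤ`
(multiplicative `ℤ`) which on the class of any `(w, 1)` is the `z`-coordinate of `heisHom w ∈ Heis ℤ`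
(well defined: `KTheta` dies under `heisHom`; a homomorphism on `Δ_Θ` because there `x = y = 0`;
injective by `mem_KTheta_iff_of_snd_eq_one`; onto because `⁅a,b⁆ ↦ (0,0,1)`).
[cite: MochizukiEtTh2009, §1 p.12] -/
theorem exists_mulEquiv_deltaTheta_int :
    ∃ e : (ThetaSetting.model p).DeltaTheta ≃* Multiplicative ℤ,
      ∀ (g : PiTp p) (hg : ((g : GTheta p)) ∈ (ThetaSetting.model p).DeltaTheta),
        e ⟨(g : GTheta p), hg⟩ = Multiplicative.ofAdd (heisHom (Del.val g.1)).z := by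
  -- the shadow `Π^tp_X → Heis ℤ`, `(w, σ) ↦ heisHom w`, descends to `(Π^tp_X)^Θ`
  let θ : PiTp p →* Heis ℤ := heisHom.comp (Del.val.comp (MonoidHom.fst Del (Gam p)))
  have hθ : ∀ g : PiTp p, θ g = heisHom (Del.val g.1) := fun _ => rfl
  have hker : KTheta p ≤ θ.ker := fun g hg => by
    rw [MonoidHom.mem_ker, hθ]
    exact (heisHom_eq_one_and_snd_eq_one_of_mem_KTheta p hg).1
  let Θ : GTheta p →* Heis ℤ := QuotientGroup.lift (KTheta p) θ hker
  have hΘ : ∀ g : PiTp p, Θ (g : GTheta p) = heisHom (Del.val g.1) := fun g => by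
    rw [QuotientGroup.lift_mk, hθ]
  -- on `Δ_Θ` the `x`- and `y`-coordinates vanish
  have hx : ∀ a : (ThetaSetting.model p).DeltaTheta, (Θ a.1).x = 0 ∧ (Θ a.1).y = 0 := by
    rintro ⟨a, ha⟩
    obtain ⟨g, rfl⟩ := QuotientGroup.mk_surjective a
    obtain ⟨h1, h2, -⟩ := exponents_eq_zero_of_mk_mem_deltaTheta p ha
    exact ⟨by rw [hΘ]; exact h1, by rw [hΘ]; exact h2⟩
  -- the `z`-coordinate is a homomorphism on `Δ_Θ`
  let f : (ThetaSetting.model p).DeltaTheta →* Multiplicative ℤ :=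
    { toFun := fun a => Multiplicative.ofAdd (Θ a.1).z
      map_one' := by simp
      map_mul' := fun a b => by
        rw [← ofAdd_add, Subgroup.coe_mul, map_mul, Heis.mul_z, (hx a).1, zero_mul, add_zero] }
  have hf : ∀ (g : PiTp p) (hg : ((g : GTheta p)) ∈ (ThetaSetting.model p).DeltaTheta),
      f ⟨(g : GTheta p), hg⟩ = Multiplicative.ofAdd (heisHom (Del.val g.1)).z := fun g hg => by
    show Multiplicative.ofAdd (Θ (g : GTheta p)).z = _
    rw [hΘ]
  -- injective
  have hinj : Function.Injective f := by
    rw [injective_iff_map_eq_one]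
    rintro ⟨a, ha⟩ h
    obtain ⟨g, rfl⟩ := QuotientGroup.mk_surjective a
    obtain ⟨h1, h2, h3⟩ := exponents_eq_zero_of_mk_mem_deltaTheta p ha
    have hz : (heisHom (Del.val g.1)).z = 0 := by
      have := hf g ha
      rw [h] at this
      exact (ofAdd_eq_one.mp this.symm)
    have hone : heisHom (Del.val g.1) = 1 := Heis.ext h1 h2 hz
    apply Subtype.ext
    show ((g : GTheta p)) = 1
    rw [QuotientGroup.eq_one_iff]
    exact (mem_KTheta_iff_of_snd_eq_one p h3).mpr hone
  -- surjective: the class of `(⁅a,b⁆, 1)` maps to the generator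
  have hc : (((Del.ofF₂ ⁅FreeGroup.of (0 : Fin 2), FreeGroup.of 1⁆, 1) : PiTp p) : GTheta p) ∈
      (ThetaSetting.model p).DeltaTheta := by
    refine (mk_mem_ker_thetaToEllM_iff p _).mpr (mem_KEll_of_mem_commutator p rfl ?_)
    show ⁅FreeGroup.of (0 : Fin 2), FreeGroup.of 1⁆ ∈ commutator F₂
    rw [commutator_def]
    exact Subgroup.commutator_mem_commutator (Subgroup.mem_top _) (Subgroup.mem_top _)
  have hfc : f ⟨_, hc⟩ = Multiplicative.ofAdd 1 := by
    rw [hf, Del.val_ofF₂, heisHom_commutator]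
  have hsurj : Function.Surjective f := by
    intro n
    refine ⟨⟨_, hc⟩ ^ (Multiplicative.toAdd n), ?_⟩
    rw [map_zpow, hfc, ← ofAdd_zsmul, smul_eq_mul, mul_one, ofAdd_toAdd]
  exact ⟨MulEquiv.ofBijective f ⟨hinj, hsurj⟩, hf⟩

/-- **`Δ_Θ(model)` is cyclic, generated by the class of `(⁅a,b⁆, 1)`** (the centre of the discrete
Heisenberg group). [cite: MochizukiEtTh2009, §1 p.12] -/
theorem deltaTheta_eq_zpowers :
    (ThetaSetting.model p).DeltaTheta =
      Subgroup.zpowers ((((Del.ofF₂ ⁅FreeGroup.of (0 : Fin 2), FreeGroup.of 1⁆, 1) : PiTp p)) : GTheta p) := by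
  obtain ⟨e, he⟩ := exists_mulEquiv_deltaTheta_int p
  have hc : (((Del.ofF₂ ⁅FreeGroup.of (0 : Fin 2), FreeGroup.of 1⁆, 1) : PiTp p) : GTheta p) ∈
      (ThetaSetting.model p).DeltaTheta := by
    refine (mk_mem_ker_thetaToEllM_iff p _).mpr (mem_KEll_of_mem_commutator p rfl ?_)
    show ⁅FreeGroup.of (0 : Fin 2), FreeGroup.of 1⁆ ∈ commutator F₂
    rw [commutator_def]
    exact Subgroup.commutator_mem_commutator (Subgroup.mem_top _) (Subgroup.mem_top _)
  have hec : e ⟨_, hc⟩ = Multiplicative.ofAdd 1 := by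
    rw [he, Del.val_ofF₂, heisHom_commutator]
  refine le_antisymm ?_ ((Subgroup.zpowers_le).mpr hc)
  intro a ha
  rw [Subgroup.mem_zpowers_iff]
  refine ⟨Multiplicative.toAdd (e ⟨a, ha⟩), ?_⟩
  have h1 : e (⟨_, hc⟩ ^ Multiplicative.toAdd (e ⟨a, ha⟩)) = e ⟨a, ha⟩ := by
    rw [map_zpow, hec, ← ofAdd_zsmul, smul_eq_mul, mul_one, ofAdd_toAdd]
  have h2 := congrArg Subtype.val (e.injective h1)
  simpa only [SubgroupClass.coe_zpow] using h2

end Literature.AnabelianGeometry.EtaleTheta.SettingModel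

end
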